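import Literature.Computability.AlgebraicComplexity.MS21SigmaPiOrbitsProofs
import Literature.Computability.AlgebraicComplexity.FormulaUnfolding
import HarnessLib

/-!
# Medini–Shpilka 2021, Thm 32 (inclusions): `ANF^{GLaff}(F) ⊊ ROF^{GL}(F) ⊊ VP_e(F)` — proofs

Discharge of the named fact `MS2021_thm_32_incl` of
`Literature/Computability/AlgebraicComplexity/MS21DenseOrbitsHittingSets.lean` (cell `val-lit`,
seat x6; classes `MS2021.ANFAffClass`, `MS2021.ROFLinClass`, `MS2021.VPeClass` as corrected in v2 of
that file — conditions at the levels `n ≥ 1`): `theorem MS2021_thm_32_incl_holds : MS2021_thm_32_incl`,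
following the printed proof (Medini–Shpilka, CCC 2021 = arXiv:2102.05632, §5 "Proof of
(ROANFisDense)", arXiv p0026:L3-L7):

* "From the definition it is obvious that `ANF^{GLaff} ⊆ ROF^{GL}`": the canonical ROANF with its
  leaves shifted by constants, `ANF_Δ(x + β)`, is a read-once polynomial (`exists_isROP_shift_anf`,
  induction on `Δ`; read-once polynomials are stable under injective renaming, `IsROP.rename`), and
  `ANF_Δ(Ax + b) = (ANF_Δ(y + b))(Ax)` (`affSubst_eq_affSubst_zero_shift`).
* "the classes are different as the degree of every polynomial in `ANF^{GLaff}` is always a power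
  of `2`, which is not necessarily the case for polynomials in `ROF^{GL}`": the witness used here is
  the constant family `f_n = 1` (a read-once formula: one leaf `0·x_1 + 1`), of degree `0`, whereas
  at level `n = 1` the only ANF orbit is that of `ANF_0 = x_1`, of degree `1` (invertible affine
  substitutions preserve the degree, `MS2021.totalDegree_affSubst`).
* `ROF^{GL} ⊆ VP_e`: a read-once polynomial with `|S|` leaves has a weighted formula with
  `≤ 3|S| - 2` nodes (`IsROP.formulaComplexity_le`), and substituting linear forms costs
  `E(g(Ax)) ≤ E(g) + (E(g) + 1)·n` (the tree's `formulaComplexity_bind₁_le`), a polynomial bound.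
* "`ROF^{GL} ⊊ VP_e`, as the example `f(x) = x²` shows": the family `x_1^{n+1}` (at level `1`:
  `x_1²`) lies in `VP_e` (`n` multiplications) but in no `ROF^{GL_n}` orbit, since a read-once
  polynomial on `m ≤ n` variables has degree `≤ m ≤ n` (`IsROP.totalDegree_le_card`) and linear
  substitutions do not raise the degree — the degree count replaces the paper's "multilinear with
  respect to some basis" (disclosed shorter road; same witness at level `1`).

Theorem-only file: no definition, no new named fact (D-0026); `VP ≠ VNP` is NOT proved and nothing
here bears on it beyond discharging a typed literature statement by name.

## References
* [MediniShpilka2021] D. Medini, A. Shpilka, CCC 2021, LIPIcs 200:19, Thm 32 eq. (5) (= arXiv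
  unnumbered ‹theoremROANFisDense›, p0008:L4-L10; proof §5, p0026:L3-L7); Def 5 (ROF), Def 8
  (`ANF_Δ`), §1.2.2 (the classes).
-/

noncomputable section

open MvPolynomial Matrix

namespace Literature.Computability.AlgebraicComplexity

namespace MS2021

/-! ### Read-once polynomials: renaming, degree, formula size -/

section ROP

variable {K : Type*} [CommSemiring K] {σ τ : Type*} [DecidableEq σ] [DecidableEq τ]

/-- A read-once formula has at least one leaf: the leaf set of a read-once polynomial is nonempty
(so there is no read-once polynomial in `0` variables — the reason for the `0 < n` guard of
`ROFLinClass`). [cite: MediniShpilka2021, Def 5 (CCC p.19:6)] -/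
theorem IsROP.nonempty {S : Finset σ} {f : MvPolynomial σ K} (h : IsROP S f) : S.Nonempty := by
  induction h with
  | leaf i α β => exact Finset.singleton_nonempty i
  | add α _ _ _ ih₁ _ => exact ih₁.mono Finset.subset_union_left
  | mul α _ _ _ ih₁ _ => exact ih₁.mono Finset.subset_union_left

/-- Read-once polynomials are stable under injective renaming of the variables (relabel the
leaves). [cite: MediniShpilka2021, Def 5 (CCC p.19:6)] -/
theorem IsROP.rename {S : Finset σ} {f : MvPolynomial σ K} (h : IsROP S f) (e : σ → τ)
    (he : Function.Injective e) : IsROP (S.image e) (MvPolynomial.rename e f) := by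
  induction h with
  | leaf i α β =>
      rw [Finset.image_singleton]
      simpa only [map_add, map_mul, rename_C, rename_X] using IsROP.leaf (K := K) (e i) α β
  | add α _ _ hd ih₁ ih₂ =>
      rw [Finset.image_union]
      simpa only [map_add, rename_C] using
        IsROP.add α ih₁ ih₂ ((Finset.disjoint_image he).mpr hd)
  | mul α _ _ hd ih₁ ih₂ =>
      rw [Finset.image_union]
      simpa only [map_add, map_mul, rename_C] using
        IsROP.mul α ih₁ ih₂ ((Finset.disjoint_image he).mpr hd)

/-- A read-once polynomial has degree at most its number of leaves ("polynomials in `ROF^{GL}` are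
multilinear with respect to some basis"). [cite: MediniShpilka2021, §5 proof of Thm 32 (arXiv p0026:L7)] -/
theorem IsROP.totalDegree_le_card {S : Finset σ} {f : MvPolynomial σ K} (h : IsROP S f) :
    f.totalDegree ≤ S.card := by
  induction h with
  | leaf i α β =>
      rw [Finset.card_singleton]
      have hX : (X i : MvPolynomial σ K).totalDegree ≤ 1 :=
        (totalDegree_monomial_le (Finsupp.single i 1) (1 : K)).trans (by simp)
      refine (totalDegree_add _ _).trans (max_le ?_ ?_)
      · refine (totalDegree_mul _ _).trans ?_
        rw [totalDegree_C, zero_add]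
        exact hX
      · rw [totalDegree_C]; exact Nat.zero_le _
  | add α _ _ hd ih₁ ih₂ =>
      rw [Finset.card_union_of_disjoint hd]
      refine (totalDegree_add _ _).trans (max_le ((totalDegree_add _ _).trans (max_le ?_ ?_)) ?_)
      · exact ih₁.trans (Nat.le_add_right _ _)
      · exact ih₂.trans (Nat.le_add_left _ _)
      · rw [totalDegree_C]; exact Nat.zero_le _
  | mul α _ _ hd ih₁ ih₂ =>
      rw [Finset.card_union_of_disjoint hd]
      refine (totalDegree_add _ _).trans
        (max_le ((totalDegree_mul _ _).trans (Nat.add_le_add ih₁ ih₂)) ?_)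
      rw [totalDegree_C]; exact Nat.zero_le _

/-- A read-once formula with `|S|` leaves unfolds to a weighted binary expression with at most
`3|S| - 2` nodes (leaf `αx_i + β` = one weighted-sum node; each internal node `Φ₁ ∗ Φ₂ + α` = two
nodes). [cite: MediniShpilka2021, Def 5 (CCC p.19:6)] -/
theorem IsROP.exists_wexpr {S : Finset σ} {f : MvPolynomial σ K} (h : IsROP S f) :
    ∃ e : WExpr K σ, e.eval = f ∧ e.size + 2 ≤ 3 * S.card := by
  induction h with
  | leaf i α β =>
      refine ⟨.lin α (.var i) β (.const 1), ?_, by simp⟩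
      simp [smul_eq_C_mul]
  | add α _ _ hd ih₁ ih₂ =>
      obtain ⟨e₁, he₁, hs₁⟩ := ih₁
      obtain ⟨e₂, he₂, hs₂⟩ := ih₂
      refine ⟨.lin 1 (.lin 1 e₁ 1 e₂) α (.const 1), ?_, ?_⟩
      · simp [he₁, he₂, smul_eq_C_mul]
      · rw [Finset.card_union_of_disjoint hd, WExpr.size_lin, WExpr.size_lin, WExpr.size_const]
        omega
  | mul α _ _ hd ih₁ ih₂ =>
      obtain ⟨e₁, he₁, hs₁⟩ := ih₁
      obtain ⟨e₂, he₂, hs₂⟩ := ih₂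
      refine ⟨.lin 1 (.mul e₁ e₂) α (.const 1), ?_, ?_⟩
      · simp [he₁, he₂, smul_eq_C_mul]
      · rw [Finset.card_union_of_disjoint hd, WExpr.size_lin, WExpr.size_mul, WExpr.size_const]
        omega

/-- **Formula size of a read-once polynomial**: `E(Φ) ≤ 3|S|` for a read-once formula with leaf set
`S` (fan-in-two `formulaComplexity` of the tree). [cite: MediniShpilka2021, Def 5 and Def 2 (CCC p.19:5-6)] -/
theorem IsROP.formulaComplexity_le {S : Finset σ} {f : MvPolynomial σ K} (h : IsROP S f) :
    formulaComplexity f ≤ 3 * S.card := by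
  obtain ⟨e, he, hs⟩ := h.exists_wexpr
  exact (exists_wexpr_iff_formulaComplexity_le f _).mp ⟨e, he, by omega⟩

/-- An affine form `∑_{j ∈ s} a_j x_j + c` has a weighted expression with exactly `|s|` nodes (one
weighted-sum node per variable). [cite: MediniShpilka2021, Def 2 (CCC p.19:5-6), formula size] -/
theorem exists_wexpr_affineForm (a : σ → K) (c : K) (s : Finset σ) :
    ∃ e : WExpr K σ, e.eval = (∑ j ∈ s, C (a j) * X j) + C c ∧ e.size = s.card := by
  induction s using Finset.induction_on with
  | empty => exact ⟨.const c, by simp, by simp⟩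
  | insert j s hj ih =>
      obtain ⟨e, he, hs⟩ := ih
      refine ⟨.lin (a j) (.var j) 1 e, ?_, ?_⟩
      · rw [WExpr.eval_lin, WExpr.eval_var, he, Finset.sum_insert hj, one_smul, smul_eq_C_mul,
          add_assoc]
      · rw [WExpr.size_lin, WExpr.size_var, hs, Finset.card_insert_of_notMem hj]
        omega

end ROP

/-! ### The canonical ROANF is a read-once polynomial; shifting the constants -/

section ANF

variable {K : Type*} [CommSemiring K]

/-- The block embeddings `x^{(i)}` of Def 8 are jointly injective: `x^{(i)}_j = x^{(i')}_{j'}` only if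
`(i, j) = (i', j')`. [cite: MediniShpilka2021, Def 8 (CCC p.19:7)] -/
theorem anfBlock_inj {Δ : ℕ} {c c' : Fin 4} {j j' : Fin (4 ^ Δ)}
    (h : anfBlock Δ c j = anfBlock Δ c' j') : c = c' ∧ j = j' :=
  Prod.mk.inj (finProdFinEquiv.injective (Fin.cast_injective _ h))

/-- **`ANF_Δ(x + β)` is a read-once polynomial**: the canonical ROANF with every leaf `x_i` replaced
by `x_i + β_i` is computed by a read-once formula ("it is a ROF on `4^Δ` many variables"), by
induction on `Δ` along Def 8. [cite: MediniShpilka2021, §1.2.2 and Def 8 (CCC p.19:7, p.19:12 "In particular, it is a ROF on 4^Δ many variables"; arXiv p0007:L93)] -/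
theorem exists_isROP_shift_anf : ∀ (Δ : ℕ) (β : Fin (4 ^ Δ) → K),
    ∃ S : Finset (Fin (4 ^ Δ)), IsROP S (aeval (fun i => X i + C (β i)) (anf K Δ))
  | 0, β => ⟨{⟨0, Nat.one_pos⟩}, by
      rw [anf, aeval_X]
      have h := IsROP.leaf (K := K) (⟨0, Nat.one_pos⟩ : Fin (4 ^ 0)) 1 (β ⟨0, Nat.one_pos⟩)
      rwa [C_1, one_mul] at h⟩
  | Δ + 1, β => by
      have hdisj : ∀ {c c' : Fin 4} (S S' : Finset (Fin (4 ^ Δ))), c ≠ c' →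
          Disjoint (S.image (anfBlock Δ c)) (S'.image (anfBlock Δ c')) := by
        intro c c' S S' hcc'
        rw [Finset.disjoint_left]
        intro x hx hx'
        rw [Finset.mem_image] at hx hx'
        obtain ⟨j, -, rfl⟩ := hx
        obtain ⟨j', -, hjj'⟩ := hx'
        exact hcc' (anfBlock_inj hjj'.symm).1
      have hblk : ∀ c : Fin 4, ∃ S : Finset (Fin (4 ^ Δ)), IsROP (S.image (anfBlock Δ c))
          (aeval (fun i => X i + C (β i)) (rename (anfBlock Δ c) (anf K Δ))) := by
        intro c
        obtain ⟨S, hS⟩ := exists_isROP_shift_anf Δ (fun j => β (anfBlock Δ c j))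
        refine ⟨S, ?_⟩
        have hfun : (fun j => rename (anfBlock Δ c) (X j + C (β (anfBlock Δ c j)))) =
            (fun i : Fin (4 ^ (Δ + 1)) => X i + C (β i)) ∘ anfBlock Δ c := by
          funext j
          simp
        rw [aeval_rename, ← hfun, ← comp_aeval, AlgHom.comp_apply]
        exact hS.rename (anfBlock Δ c) fun a b h => (anfBlock_inj h).2
      obtain ⟨S₀, h₀⟩ := hblk 0
      obtain ⟨S₁, h₁⟩ := hblk 1
      obtain ⟨S₂, h₂⟩ := hblk 2
      obtain ⟨S₃, h₃⟩ := hblk 3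
      refine ⟨(S₀.image (anfBlock Δ 0) ∪ S₁.image (anfBlock Δ 1)) ∪
        (S₂.image (anfBlock Δ 2) ∪ S₃.image (anfBlock Δ 3)), ?_⟩
      have key := IsROP.add (0 : K) (IsROP.mul (0 : K) h₀ h₁ (hdisj S₀ S₁ (by decide)))
        (IsROP.mul (0 : K) h₂ h₃ (hdisj S₂ S₃ (by decide)))
        (Finset.disjoint_union_left.mpr
          ⟨Finset.disjoint_union_right.mpr ⟨hdisj _ _ (by decide), hdisj _ _ (by decide)⟩,
           Finset.disjoint_union_right.mpr ⟨hdisj _ _ (by decide), hdisj _ _ (by decide)⟩⟩)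
      simp only [C_0, add_zero] at key
      simpa only [anf, map_add, map_mul] using key

end ANF

/-! ### Affine versus linear orbits: moving the shift into the formula -/

section Shift

variable {K : Type*} [Field K] {m n : ℕ}

/-- `f(Ax + b) = g(Ax)` with `g(y) = f(y + b')`, `b'_i = b_i` (`i ≤ m`): an affine orbit of `f` is
the linear orbit of a shift of `f`. [cite: MediniShpilka2021, §1.1.6 (CCC p.19:9; arXiv p0007:L7-L20)] -/
theorem affSubst_eq_affSubst_zero_shift (h : m ≤ n) (A : Matrix (Fin n) (Fin n) K) (b : Fin n → K)
    (f : MvPolynomial (Fin m) K) :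
    affSubst h A b f =
      affSubst h A 0 (aeval (fun i : Fin m => X i + C (b (Fin.castLE h i))) f) := by
  have hfun : (fun i : Fin m => (∑ j : Fin n, C (A (Fin.castLE h i) j) * X j) + C (b (Fin.castLE h i)))
      = fun i => aeval (fun i : Fin m => (∑ j : Fin n, C (A (Fin.castLE h i) j) * X j) +
          C ((0 : Fin n → K) (Fin.castLE h i))) (X i + C (b (Fin.castLE h i))) := by
    funext i
    simp
  unfold affSubst
  rw [hfun, ← comp_aeval, AlgHom.comp_apply]

/-- `deg f(Ax) ≤ deg f ≤ |S|` for a read-once `f` with leaf set `S`: members of `Φ^{GL_n}` have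
degree at most the number of leaves of `Φ`. [cite: MediniShpilka2021, §5 proof of Thm 32 (arXiv p0026:L7)] -/
theorem totalDegree_le_card_of_mem_linOrbit {S : Finset (Fin m)} {g : MvPolynomial (Fin m) K}
    (hg : IsROP S g) {f : MvPolynomial (Fin n) K} (hf : f ∈ linOrbit n g) :
    f.totalDegree ≤ S.card := by
  obtain ⟨h, A, -, rfl⟩ := hf
  exact (totalDegree_affSubst_le h A 0 g).trans hg.totalDegree_le_card

/-- **Formula size in a linear orbit of a read-once formula**: for `Φ` read-once on `m ≤ n`
variables and `f ∈ Φ^{GL_n}`, `E(f) ≤ 3n + (3n + 1)·n` (substitute the `n`-variate linear forms,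
of formula size `≤ n`, into the `≤ 3m` nodes of `Φ`). [cite: MediniShpilka2021, §5 proof of Thm 32 (arXiv p0026:L7) with Def 2 (formula size)] -/
theorem formulaComplexity_le_of_mem_linOrbit {S : Finset (Fin m)} {g : MvPolynomial (Fin m) K}
    (hg : IsROP S g) (hm : m ≤ n) {f : MvPolynomial (Fin n) K} (hf : f ∈ linOrbit n g) :
    formulaComplexity f ≤ 3 * n + (3 * n + 1) * n := by
  classical
  obtain ⟨h, A, -, rfl⟩ := hf
  have hS : S.card ≤ n := (Finset.card_le_univ S).trans (by simpa using hm)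
  have hEg : formulaComplexity g ≤ 3 * n := hg.formulaComplexity_le.trans (by omega)
  have hL : ∀ i : Fin m, formulaComplexity ((∑ j : Fin n, C (A (Fin.castLE h i) j) * X j) +
      C ((0 : Fin n → K) (Fin.castLE h i))) ≤ n := by
    intro i
    obtain ⟨e, he, hs⟩ := exists_wexpr_affineForm (fun j => A (Fin.castLE h i) j)
      ((0 : Fin n → K) (Fin.castLE h i)) Finset.univ
    refine (exists_wexpr_iff_formulaComplexity_le _ _).mp ⟨e, he, ?_⟩
    rw [hs, Finset.card_univ, Fintype.card_fin]
  unfold affSubst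
  rw [aeval_eq_bind₁]
  refine (formulaComplexity_bind₁_le hL g).trans ?_
  exact Nat.add_le_add hEg (Nat.mul_le_mul_right n (Nat.add_le_add_right hEg 1))

end Shift

end MS2021

/-! ### The discharge -/

section Discharge

open MS2021

/-- `ANF^{GLaff}(F) ⊆ ROF^{GL}(F)` ("obvious from the definition": `ANF_Δ(Ax+b) = Φ(Ax)` for the
read-once formula `Φ(y) = ANF_Δ(y + b)` on `4^Δ ≤ n` variables).
[cite: MediniShpilka2021, Thm 32 eq. (5) (CCC p.19:12; arXiv p0008:L9, proof p0026:L4)] -/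
theorem MS2021.anfAffClass_subset_rofLinClass (K : Type) [Field K] :
    ANFAffClass K ⊆ ROFLinClass K := by
  intro f hf n hn
  obtain ⟨Δ, hΔ, h, A, b, hA, heq⟩ := hf n hn
  obtain ⟨S, hS⟩ := exists_isROP_shift_anf (K := K) Δ (fun i => b (Fin.castLE h i))
  exact ⟨4 ^ Δ, S, _, hΔ, hS, h, A, hA, by rw [heq, affSubst_eq_affSubst_zero_shift]⟩

/-- `ANF^{GLaff}(F) ≠ ROF^{GL}(F)`: degrees in `ANF^{GLaff}` are powers of `2` (at level `n = 1`: the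
orbit of `ANF_0 = x_1` consists of degree-`1` polynomials, by degree preservation), while the
constant family `1` — a read-once formula with one leaf `0·x_1 + 1` — has degree `0`.
[cite: MediniShpilka2021, Thm 32 eq. (5) and §5 proof (arXiv p0026:L5 "the degree of every polynomial in ANF^{GLaff} is always a power of 2")] -/
theorem MS2021.anfAffClass_ne_rofLinClass (K : Type) [Field K] :
    ANFAffClass K ≠ ROFLinClass K := by
  classical
  intro hEq
  -- the constant family `1`: at level `n ≥ 1` the read-once formula with the single leaf `0·x_1 + 1`
  have hmem : (fun n => (1 : MvPolynomial (Fin n) K)) ∈ ROFLinClass K := by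
    intro n hn
    have hleaf : IsROP ({(⟨0, hn⟩ : Fin n)} : Finset (Fin n))
        (C (0 : K) * X (⟨0, hn⟩ : Fin n) + C 1) := IsROP.leaf _ 0 1
    have horb : (1 : MvPolynomial (Fin n) K) ∈ linOrbit n (C (0 : K) * X (⟨0, hn⟩ : Fin n) + C 1) := by
      refine ⟨le_rfl, 1, by simp, ?_⟩
      rw [affSubst_one_zero, C_0, zero_mul, zero_add, C_1]
    exact ⟨n, _, _, le_rfl, hleaf, horb⟩
  rw [← hEq] at hmem
  obtain ⟨Δ, hΔ, h, A, b, hA, heq⟩ := hmem 1 Nat.one_pos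
  have hΔ0 : Δ = 0 := by
    by_contra hne
    have h4 : 4 ≤ 4 ^ Δ := Nat.le_self_pow hne 4
    omega
  subst hΔ0
  have heq' : (1 : MvPolynomial (Fin 1) K) = affSubst h A b (anf K 0) := heq
  have hdeg := congrArg MvPolynomial.totalDegree heq'
  rw [totalDegree_one, totalDegree_affSubst h hA, anf, totalDegree_X] at hdeg
  exact zero_ne_one hdeg

/-- `ROF^{GL}(F) ⊆ VP_e(F)`: `E(f_n) ≤ 3n + (3n+1)·n ≤ 7(n+1)²`
(`formulaComplexity_le_of_mem_linOrbit`; the level-`0` member is a constant, of size `0`).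
[cite: MediniShpilka2021, Thm 32 eq. (5) (CCC p.19:12; arXiv p0008:L9, proof p0026:L7)] -/
theorem MS2021.rofLinClass_subset_vpeClass (K : Type) [Field K] :
    ROFLinClass K ⊆ VPeClass K := by
  intro f hf
  refine (IsPBounded.iff_exists_le_mul_succ_pow _).mpr ⟨7, 2, fun n => ?_⟩
  rcases Nat.eq_zero_or_pos n with rfl | hn
  · have h0 : formulaComplexity (f 0) ≤ 0 := by
      rw [eq_C_of_isEmpty (f 0)]
      exact (exists_wexpr_iff_formulaComplexity_le _ 0).mp
        ⟨.const (coeff 0 (f 0)), WExpr.eval_const _, le_rfl⟩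
    exact h0.trans (Nat.zero_le _)
  · obtain ⟨m, S, g, hm, hS, hf'⟩ := hf n hn
    refine (formulaComplexity_le_of_mem_linOrbit hS hm hf').trans ?_
    nlinarith [Nat.zero_le n]

/-- `ROF^{GL}(F) ≠ VP_e(F)` ("as the example `f(x) = x²` shows"): the family `x_1^{n+1}` has
formulas of size `n` but degree `n + 1 > n ≥` the degree of any member of a `ROF^{GL_n}` orbit.
[cite: MediniShpilka2021, Thm 32 eq. (5) and §5 proof (arXiv p0026:L7)] -/
theorem MS2021.rofLinClass_ne_vpeClass (K : Type) [Field K] :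
    ROFLinClass K ≠ VPeClass K := by
  classical
  -- the witness family `x_1^{n+1}` (zero at the empty level `n = 0`)
  let pw : ∀ n, MvPolynomial (Fin n) K := fun n =>
    if hn : 0 < n then X (⟨0, hn⟩ : Fin n) ^ (n + 1) else 0
  have pw_pos : ∀ n (hn : 0 < n), pw n = X (⟨0, hn⟩ : Fin n) ^ (n + 1) := fun n hn => dif_pos hn
  -- `x^{k+1}` has a weighted expression with `k` product nodes
  have hpow : ∀ (n : ℕ) (i : Fin n) (k : ℕ), ∃ e : WExpr K (Fin n),
      e.eval = X i ^ (k + 1) ∧ e.size = k := by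
    intro n i k
    induction k with
    | zero => exact ⟨.var i, by simp, by simp⟩
    | succ k ih =>
        obtain ⟨e, he, hs⟩ := ih
        exact ⟨.mul e (.var i), by simp [he, pow_succ], by simp [hs]⟩
  have hmem : pw ∈ VPeClass K := by
    refine ⟨1, fun n => ?_⟩
    show formulaComplexity (pw n) ≤ n ^ 1 + 1
    rcases Nat.eq_zero_or_pos n with rfl | hn
    · have h0 : formulaComplexity (pw 0) ≤ 0 := by
        rw [eq_C_of_isEmpty (pw 0)]
        exact (exists_wexpr_iff_formulaComplexity_le _ 0).mp
          ⟨.const (coeff 0 (pw 0)), WExpr.eval_const _, le_rfl⟩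
      exact h0.trans (Nat.zero_le _)
    · obtain ⟨e, he, hs⟩ := hpow n ⟨0, hn⟩ n
      rw [pw_pos n hn, pow_one]
      exact ((exists_wexpr_iff_formulaComplexity_le _ n).mp ⟨e, he, hs.le⟩).trans (Nat.le_succ n)
  intro hEq
  rw [← hEq] at hmem
  obtain ⟨m, S, g, hm, hS, hf⟩ := hmem 1 Nat.one_pos
  have h1 : (pw 1).totalDegree ≤ 1 :=
    (totalDegree_le_card_of_mem_linOrbit hS hf).trans
      ((Finset.card_le_univ S).trans (by simpa using hm))
  have h2 : (pw 1).totalDegree = 2 := by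
    rw [pw_pos 1 Nat.one_pos, totalDegree_X_pow]
  omega

/-- **MS Thm 32 (inclusions), discharged**: `ANF^{GLaff}(F) ⊊ ROF^{GL}(F) ⊊ VP_e(F)` for every
field `F` (classes of families at the levels `n ≥ 1`, v2 of the statement file).
[cite: MediniShpilka2021, Thm 32 eq. (5) (CCC 2021 LIPIcs 200:19, p.19:12; = arXiv:2102.05632 unnumbered ‹theoremROANFisDense› p0008:L4-L10; proof §5 p0026:L3-L7)] -/
theorem MS2021_thm_32_incl_holds : MS2021_thm_32_incl := fun K _ =>
  ⟨MS2021.anfAffClass_subset_rofLinClass K, MS2021.anfAffClass_ne_rofLinClass K,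
    MS2021.rofLinClass_subset_vpeClass K, MS2021.rofLinClass_ne_vpeClass K⟩

end Discharge

end Literature.Computability.AlgebraicComplexity

end
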